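import Summits.Ventures.HodgeRepro2.T5SU11FibrationCocycle
import Summits.Ventures.HodgeRepro2.T5SU11FibrationHaar

/-!
# Integration over `G/K = 𝔻`: `∫_G F(g·0) dg = μ_K(K) · ∫_𝔻 F(z) (1 - |z|²)⁻² dA(z)`

A right-`K`-invariant function on `SU(1,1)` is a function of the orbit point `g·0 ∈ 𝔻`
(`right_rot_invariant_eq`: `f g = f (s(g·0))` by the polar decomposition
`T5SU11FibrationCocycle.eq_sec_orbit_mul_rot`), and the Haar measure `ν = Φ_*(poincare ⊗ μ_K)` of
`T5SU11FibrationHaar` integrates it over the disc: for `F : ℂ → E`,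
**`∫_G F(g·0) dν(g) = μ_K(K) · ∫_𝔻 F(z) dpoincare(z)`** (`lintegral_nu_comp_orbit` for every
measurable `F ≥ 0`, `integral_nu_comp_orbit` for `ν`-integrable `F ∘ orbit`), with
`∫_𝔻 F dpoincare = ∫_{|z|<1} (1 - |z|²)⁻² F(z) dA(z)` (`integral_poincare_eq`, every `F`) — the
classical «`G/K` carries the hyperbolic area» formula for the explicit model. Variants: for a
probability Haar measure of `K` the factor is `1` (`integral_nu_comp_orbit_of_probability`), for
every Haar measure `μ` of `SU(1,1)` the formula holds up to the scalar `c = haarScalarFactor ν μ`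
(`integral_haar_comp_orbit`), and a right-`K`-invariant `f` itself integrates as
`∫_G f dν = μ_K(K) · ∫_𝔻 f(s(z)) dpoincare(z)` (`integral_nu_of_right_rot_invariant`). Nothing is
claimed about (N).

Blind lane: Mathlib + the HodgeRepro2 prefix only; no sorry; axioms ⊆ {propext, Classical.choice,
Quot.sound}.
-/

namespace Summit.Ventures.HodgeRepro2.T5SU11QuotientIntegral

open MeasureTheory MeasureTheory.Measure Metric Filter Topology Set Complex
open T5PoincareDensity T5PoincareInvariance T5PoincareMeasure T5SU11Unimodular T5SU11Fibration
  T5SU11FibrationHaar T5SU11Cartan T5SU11OneParameter T5BergmanCoefficient T5SU11FibrationCocycle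
open scoped ENNReal NNReal

/-! ### Right-`K`-invariant functions are functions of the orbit point -/

/-- A right-`K`-invariant function is determined by its values on the section:
`f g = f (s(g·0))`. -/
theorem right_rot_invariant_eq {E : Type*} (f : SU11 → E) (hf : ∀ g u, f (g * rot u) = f g)
    (g : SU11) : f g = f (sec (orbit g)) := by
  conv_lhs => rw [eq_sec_orbit_mul_rot g]
  exact hf _ _

/-- A right-`K`-invariant function factors through the orbit map: `f = (f ∘ s) ∘ orbit`. -/
theorem right_rot_invariant_eq_comp {E : Type*} (f : SU11 → E) (hf : ∀ g u, f (g * rot u) = f g) :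
    f = (fun z => f (sec z)) ∘ orbit :=
  funext fun g => right_rot_invariant_eq f hf g

/-- `Φ(z, u)·0 = z` `poincare`-almost everywhere (the Poincaré measure lives on the disc). -/
lemma ae_orbit_fib (u : Circle) : ∀ᵐ z ∂poincare, orbit (fib (z, u)) = z := by
  have h : ∀ᵐ z ∂poincare, z ∈ ball (0 : ℂ) 1 := mem_ae_iff.mpr poincare_compl_ball
  filter_upwards [h] with z hz
  exact orbit_fib hz u

/-! ### The Poincaré integral as a weighted area integral -/

/-- **`∫_𝔻 F dpoincare = ∫_{|z|<1} (1 - |z|²)⁻² F(z) dA(z)`** for EVERY `F`. -/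
theorem integral_poincare_eq {E : Type*} [NormedAddCommGroup E] [NormedSpace ℝ E] (F : ℂ → E) :
    ∫ z, F z ∂poincare = ∫ z in ball (0 : ℂ) 1, dens z • F z := by
  have hd : Measurable fun z : ℂ => Real.toNNReal (dens z) := measurable_dens.real_toNNReal
  have e : poincare = (volume.restrict (ball 0 1)).withDensity
      fun z => ((Real.toNNReal (dens z) : ℝ≥0) : ℝ≥0∞) := rfl
  rw [e, integral_withDensity_eq_integral_smul hd]
  congr 1
  ext z
  rw [NNReal.smul_def, Real.coe_toNNReal _ (dens_nonneg z)]

section measure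

variable [MeasurableSpace Circle] [BorelSpace Circle] (μC : Measure Circle) [IsHaarMeasure μC]

/-! ### `∫_G F(g·0) dν = μ_K(K) · ∫_𝔻 F dpoincare` -/

/-- **Integration over `G/K = 𝔻`, `lintegral` form**: for every measurable `F : ℂ → ℝ≥0∞`,
`∫⁻_G F(g·0) dν = μ_K(K) · ∫⁻_𝔻 F dpoincare`. -/
theorem lintegral_nu_comp_orbit (F : ℂ → ℝ≥0∞) (hF : Measurable F) :
    ∫⁻ g, F (orbit g) ∂(nu μC) = μC Set.univ * ∫⁻ z, F z ∂poincare := by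
  have hm : Measurable fun g : SU11 => F (orbit g) := hF.comp continuous_orbit.measurable
  have hm' : AEMeasurable (fun p : ℂ × Circle => F (orbit (fib p))) (poincare.prod μC) :=
    (hF.comp (continuous_orbit.measurable.comp measurable_fib)).aemeasurable
  rw [show nu μC = Measure.map fib (poincare.prod μC) from rfl, lintegral_map hm measurable_fib,
    lintegral_prod (fun p : ℂ × Circle => F (orbit (fib p))) hm']
  have h : ∀ᵐ z ∂poincare, ∫⁻ u, F (orbit (fib (z, u))) ∂μC = F z * μC Set.univ := by
    have hb : ∀ᵐ z ∂poincare, z ∈ ball (0 : ℂ) 1 := mem_ae_iff.mpr poincare_compl_ball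
    filter_upwards [hb] with z hz
    simp only [orbit_fib hz]
    rw [lintegral_const]
  rw [lintegral_congr_ae h, lintegral_mul_const _ hF, mul_comm]

/-- **Integration over `G/K = 𝔻`**: for `F : ℂ → E` with `F ∘ orbit` `ν`-integrable,
`∫_G F(g·0) dν(g) = μ_K(K) • ∫_𝔻 F dpoincare`. -/
theorem integral_nu_comp_orbit {E : Type*} [NormedAddCommGroup E] [NormedSpace ℝ E]
    [CompleteSpace E] (F : ℂ → E) (hF : Integrable (fun g => F (orbit g)) (nu μC)) :
    ∫ g, F (orbit g) ∂(nu μC) = (μC Set.univ).toReal • ∫ z, F z ∂poincare := by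
  have hint' : Integrable (fun p : ℂ × Circle => F (orbit (fib p))) (poincare.prod μC) :=
    (integrable_map_measure hF.aestronglyMeasurable measurable_fib.aemeasurable).mp hF
  rw [show nu μC = Measure.map fib (poincare.prod μC) from rfl,
    integral_map measurable_fib.aemeasurable hF.aestronglyMeasurable,
    integral_prod (fun p : ℂ × Circle => F (orbit (fib p))) hint']
  have h : ∀ᵐ z ∂poincare, ∫ u, F (orbit (fib (z, u))) ∂μC = (μC Set.univ).toReal • F z := by
    have hb : ∀ᵐ z ∂poincare, z ∈ ball (0 : ℂ) 1 := mem_ae_iff.mpr poincare_compl_ball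
    filter_upwards [hb] with z hz
    simp only [orbit_fib hz]
    rw [integral_const, measureReal_def]
  rw [integral_congr_ae h, integral_smul]

/-- **Integration over `G/K = 𝔻` as a weighted area integral**:
`∫_G F(g·0) dν(g) = μ_K(K) • ∫_{|z|<1} (1 - |z|²)⁻² F(z) dA(z)`. -/
theorem integral_nu_comp_orbit' {E : Type*} [NormedAddCommGroup E] [NormedSpace ℝ E]
    [CompleteSpace E] (F : ℂ → E) (hF : Integrable (fun g => F (orbit g)) (nu μC)) :
    ∫ g, F (orbit g) ∂(nu μC) = (μC Set.univ).toReal • ∫ z in ball (0 : ℂ) 1, dens z • F z := by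
  rw [integral_nu_comp_orbit μC F hF, integral_poincare_eq]

/-- For a probability Haar measure of `K` the factor is `1`:
`∫_G F(g·0) dν = ∫_𝔻 F dpoincare`. -/
theorem integral_nu_comp_orbit_of_probability [IsProbabilityMeasure μC] {E : Type*}
    [NormedAddCommGroup E] [NormedSpace ℝ E] [CompleteSpace E] (F : ℂ → E)
    (hF : Integrable (fun g => F (orbit g)) (nu μC)) :
    ∫ g, F (orbit g) ∂(nu μC) = ∫ z, F z ∂poincare := by
  rw [integral_nu_comp_orbit μC F hF, measure_univ, ENNReal.toReal_one, one_smul]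

/-- **A right-`K`-invariant function integrates over the disc**:
`∫_G f dν = μ_K(K) • ∫_𝔻 f(s(z)) dpoincare(z)` for `ν`-integrable right-`K`-invariant `f`. -/
theorem integral_nu_of_right_rot_invariant {E : Type*} [NormedAddCommGroup E] [NormedSpace ℝ E]
    [CompleteSpace E] (f : SU11 → E) (hf : Integrable f (nu μC))
    (hK : ∀ g u, f (g * rot u) = f g) :
    ∫ g, f g ∂(nu μC) = (μC Set.univ).toReal • ∫ z, f (sec z) ∂poincare := by
  have hf' : Integrable (fun g => (fun z => f (sec z)) (orbit g)) (nu μC) :=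
    hf.congr (Filter.Eventually.of_forall fun g => right_rot_invariant_eq f hK g)
  rw [← integral_nu_comp_orbit μC (fun z => f (sec z)) hf']
  exact integral_congr_ae (Filter.Eventually.of_forall fun g => right_rot_invariant_eq f hK g)

/-- **For every Haar measure `μ` of `SU(1,1)`**: `c • ∫_G F(g·0) dμ = μ_K(K) • ∫_𝔻 F dpoincare` with
`c = haarScalarFactor ν μ > 0`. -/
theorem integral_haar_comp_orbit (μ : Measure SU11) [IsHaarMeasure μ] {E : Type*}
    [NormedAddCommGroup E] [NormedSpace ℝ E] [CompleteSpace E] (F : ℂ → E)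
    (hF : Integrable (fun g => F (orbit g)) μ) :
    (haarScalarFactor (nu μC) μ : ℝ) • ∫ g, F (orbit g) ∂μ =
      (μC Set.univ).toReal • ∫ z, F z ∂poincare := by
  set c := haarScalarFactor (nu μC) μ with hc
  have hnu : nu μC = c • μ := nu_eq_smul μC μ
  have hint : Integrable (fun g => F (orbit g)) (nu μC) := by
    rw [hnu]
    exact hF.smul_measure ENNReal.coe_ne_top
  have h1 : ∫ g, F (orbit g) ∂(nu μC) = (c : ℝ) • ∫ g, F (orbit g) ∂μ := by
    rw [hnu, integral_smul_nnreal_measure, NNReal.smul_def]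
  rw [← h1, integral_nu_comp_orbit μC F hint]

end measure

end Summit.Ventures.HodgeRepro2.T5SU11QuotientIntegral
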